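import Literature.Analysis.FluidPDE.PassiveVectorGalerkinIdentity
import Literature.Analysis.FluidPDE.PassiveVectorDissipationBound
import Literature.Analysis.FluidPDE.DuchonRobertLionsEnergyEquality
import HarnessLib

/-!
# Weak passive-vector solutions: time bookkeeping of the truncated quantities

Analysis/FluidPDE proof-support file (everything proved; no definitions). Inputs for the limit
`N → ∞` in the truncated energy identity of `PassiveVectorGalerkinIdentity` for a weak solution
`Torus.IsWeakPassiveVectorOn A T ν b w₀ w` (Yoshida–Kaneda 2000, (4)–(5)):

* time-measurability of the truncated dissipation `s ↦ ‖∇P_N w(s)‖₂²`, its domination by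
  `‖∇w(s)‖₂²` and its integrability on `(0,T)` when the dissipation is finite
  (`∫₀ᵀ‖∇P_N w‖₂² ≤ (∫⁻₀ᵀ‖∇w‖₂²).toReal`);
* integrability of the slice energy `s ↦ ∫‖w(s)‖²` and of the **Parseval tails**
  `s ↦ ∫‖w(s) - P_N w(s)‖²`, dominated by `4∫‖w(s)‖²` and tending to `0` for a.e. `s`, whence
  `∫₀ᵀ∫‖w - P_N w‖² → 0` (dominated convergence; Robinson–Rodrigo–Sadowski 2016, Lemma 4.1);
* for `A = 0` and a carrier bounded by `M` a.e.: the flux of the truncated identity is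
  `∫⟪w - P_N w, (b·∇)P_N w⟫ - ν‖∇P_N w‖₂²` a.e. in `s`, with the remainder bounded by
  `d M (∫‖w - P_N w‖²)^{1/2} ‖∇P_N w‖₂` (`ae_galerkinFlux_eq_remainder`, RRS 2016 (4.20)).

The energy equality itself is `PassiveVectorEnergyEquality`; consumer: route `SolenoidalFractalHomogenisation`,
support item `CascadeBookkeeping` (cell `ad-ideate`).

## Mathlib / tree search

Tree: `PassiveVectorGalerkinIdentity`, `PassiveVectorDissipationBound`, `DuchonRobertLionsEnergyEquality`
(measurability of truncations of jointly measurable families), `StatisticalSolutionEnergyEq`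
(`eGradNormSq_fourierTruncate_le`), `NSHopfLimit` (`Torus.aemeasurable_eGradNormSq_of_coeff`), `TorusTrigPoly`
(`tendsto_lintegral_enorm_sq_fourierTruncate_sub`, Bessel). Mathlib: dominated convergence.

## References

* J. C. Robinson, J. L. Rodrigo, W. Sadowski, *The three-dimensional Navier–Stokes equations*
  (CUP 2016), Lemma 4.1, §4.2 (4.20). [`RobinsonRodrigoSadowski2016`]
* K. Yoshida, Y. Kaneda, Phys. Rev. E 63 (2000) 016308, §II eq. (4)–(5). [`YoshidaKaneda2000`]
-/

noncomputable section

open MeasureTheory Set Filter Function TopologicalSpace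
open scoped ENNReal NNReal InnerProductSpace Topology

namespace Literature.Analysis.FluidPDE

namespace Torus

variable {d : Type*} [Fintype d] [DecidableEq d]

namespace IsWeakPassiveVectorOn

variable {A T ν : ℝ} {b w : ℝ → UnitAddTorus d → EuclideanSpace ℝ d} {w₀ : UnitAddTorus d → EuclideanSpace ℝ d}

/-! ## Time-measurability and integrability of the truncated quantities -/

/-- Time-measurability of the truncated dissipation `s ↦ ‖∇P_N w(s)‖₂²` of a weak solution.
[cite: RobinsonRodrigoSadowski2016, §4.1 (Galerkin truncations)] -/
theorem aemeasurable_eGradNormSq_fourierTruncate (h : IsWeakPassiveVectorOn A T ν b w₀ w) (N : ℕ) :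
    AEMeasurable (fun s => FunctionSpaces.Torus.eGradNormSq (FunctionSpaces.Torus.fourierTruncate N (w s)))
      (volume.restrict (Ioo 0 T)) := by
  classical
  refine Torus.aemeasurable_eGradNormSq_of_coeff fun k => ?_
  have hc := Torus.aestronglyMeasurable_mFourierCoeff_complexify_slice h.aestronglyMeasurable_uncurry k
  by_cases hk : k ∈ FunctionSpaces.Torus.freqBall N
  · refine hc.congr ?_
    filter_upwards [h.ae_integrable_slice] with s hs
    rw [FunctionSpaces.Torus.mFourierCoeff_fourierTruncate hs.1, if_pos hk]
  · refine (aestronglyMeasurable_const (b := (0 : EuclideanSpace ℂ d))).congr ?_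
    filter_upwards [h.ae_integrable_slice] with s hs
    rw [FunctionSpaces.Torus.mFourierCoeff_fourierTruncate hs.1, if_neg hk]

/-- The truncated dissipation is dominated by the dissipation: `‖∇P_N w(s)‖₂² ≤ ‖∇w(s)‖₂²` for a.e. `s`.
[cite: RobinsonRodrigoSadowski2016, §4.1 (Lemma 4.1)] -/
theorem ae_eGradNormSq_fourierTruncate_le (h : IsWeakPassiveVectorOn A T ν b w₀ w) (N : ℕ) :
    ∀ᵐ s ∂(volume.restrict (Ioo 0 T)),
      FunctionSpaces.Torus.eGradNormSq (FunctionSpaces.Torus.fourierTruncate N (w s)) ≤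
        FunctionSpaces.Torus.eGradNormSq (w s) := by
  filter_upwards [h.ae_integrable_slice] with s hs
  exact Torus.eGradNormSq_fourierTruncate_le hs.1 N

/-- **Integrability of the truncated dissipation** on `(0,T)` when the dissipation is finite, with
`∫₀ᵀ ‖∇P_N w‖₂² ≤ (∫⁻₀ᵀ ‖∇w‖₂²).toReal`. [cite: RobinsonRodrigoSadowski2016, §4.2 (4.20)] -/
theorem integrableOn_toReal_eGradNormSq_fourierTruncate (h : IsWeakPassiveVectorOn A T ν b w₀ w)
    (hfin : ∫⁻ s in Ioo 0 T, FunctionSpaces.Torus.eGradNormSq (w s) < ⊤) (N : ℕ) :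
    IntegrableOn (fun s => (FunctionSpaces.Torus.eGradNormSq (FunctionSpaces.Torus.fourierTruncate N (w s))).toReal)
      (Ioo 0 T) ∧
    ∫ s in Ioo 0 T, (FunctionSpaces.Torus.eGradNormSq (FunctionSpaces.Torus.fourierTruncate N (w s))).toReal ≤
      (∫⁻ s in Ioo 0 T, FunctionSpaces.Torus.eGradNormSq (w s)).toReal := by
  have hle : ∫⁻ s in Ioo 0 T, FunctionSpaces.Torus.eGradNormSq (FunctionSpaces.Torus.fourierTruncate N (w s)) ≤
      ∫⁻ s in Ioo 0 T, FunctionSpaces.Torus.eGradNormSq (w s) := lintegral_mono_ae (h.ae_eGradNormSq_fourierTruncate_le N)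
  have hfinN := ne_top_of_le_ne_top hfin.ne hle
  refine ⟨integrable_toReal_of_lintegral_ne_top (h.aemeasurable_eGradNormSq_fourierTruncate N) hfinN, ?_⟩
  rw [integral_toReal (h.aemeasurable_eGradNormSq_fourierTruncate N)
    (ae_of_all _ fun s => FunctionSpaces.Torus.eGradNormSq_lt_top (FunctionSpaces.Torus.isSmooth_fourierTruncate N _))]
  exact ENNReal.toReal_mono hfin.ne hle

/-- The slice energy `s ↦ ∫ ‖w(s)‖²` is integrable on `(0,T)` (`w ∈ L^∞_t L²_x`).
[cite: RobinsonRodrigoSadowski2016, §4.2 (Galerkin energy estimate)] -/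
theorem integrableOn_integral_norm_sq (h : IsWeakPassiveVectorOn A T ν b w₀ w) :
    IntegrableOn (fun s => ∫ x, ‖w s x‖ ^ 2) (Ioo 0 T) := by
  obtain ⟨C, hC⟩ := h.ae_lintegral_sq_le
  have hm : AEStronglyMeasurable (fun s => ∫ x, ‖w s x‖ ^ 2) (volume.restrict (Ioo 0 T)) :=
    (h.aestronglyMeasurable_uncurry.norm.pow 2).integral_prod_right'
  refine IntegrableOn.of_bound measure_Ioo_lt_top hm (C : ℝ) ?_
  filter_upwards [hC, h.ae_memLp_two] with s hs hm2
  rw [Real.norm_eq_abs, abs_of_nonneg (integral_nonneg fun x => sq_nonneg _)]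
  have e : ∫⁻ x, ‖w s x‖ₑ ^ 2 = ENNReal.ofReal (∫ x, ‖w s x‖ ^ 2) := by
    rw [ofReal_integral_eq_lintegral_ofReal (hm2.integrable_norm_pow two_ne_zero) (ae_of_all _ fun x => by positivity)]
    refine lintegral_congr_ae (ae_of_all _ fun x => ?_)
    dsimp only
    rw [ENNReal.ofReal_pow (norm_nonneg _), ofReal_norm]
  rw [e] at hs
  exact (ENNReal.ofReal_le_iff_le_toReal ENNReal.coe_ne_top).1 hs |>.trans_eq (ENNReal.coe_toReal C)

/-- **The Parseval tails** `s ↦ ∫ ‖w(s) - P_N w(s)‖²` are integrable on `(0,T)`, dominated by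
`4∫‖w(s)‖²`, and tend to `0` for a.e. `s` as `N → ∞`. [cite: RobinsonRodrigoSadowski2016, §4.1 (Lemma 4.1)] -/
theorem galerkin_tail (h : IsWeakPassiveVectorOn A T ν b w₀ w) :
    (∀ N, IntegrableOn (fun s => ∫ x, ‖w s x - FunctionSpaces.Torus.fourierTruncate N (w s) x‖ ^ 2) (Ioo 0 T)) ∧
    (∀ N, ∀ᵐ s ∂(volume.restrict (Ioo 0 T)),
      ‖∫ x, ‖w s x - FunctionSpaces.Torus.fourierTruncate N (w s) x‖ ^ 2‖ ≤ 4 * ∫ x, ‖w s x‖ ^ 2) ∧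
    ∀ᵐ s ∂(volume.restrict (Ioo 0 T)),
      Tendsto (fun N => ∫ x, ‖w s x - FunctionSpaces.Torus.fourierTruncate N (w s) x‖ ^ 2) atTop (𝓝 0) := by
  -- pointwise (in `s`) facts at good times
  have hgood : ∀ᵐ s ∂(volume.restrict (Ioo 0 T)), MemLp (w s) 2 volume := h.ae_memLp_two
  have hbound : ∀ N, ∀ᵐ s ∂(volume.restrict (Ioo 0 T)),
      ‖∫ x, ‖w s x - FunctionSpaces.Torus.fourierTruncate N (w s) x‖ ^ 2‖ ≤ 4 * ∫ x, ‖w s x‖ ^ 2 := by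
    intro N
    filter_upwards [hgood] with s hs
    have hP : MemLp (FunctionSpaces.Torus.fourierTruncate N (w s)) 2 volume := FunctionSpaces.Torus.memLp_fourierTruncate N _ 2
    rw [Real.norm_eq_abs, abs_of_nonneg (integral_nonneg fun x => sq_nonneg _)]
    have hpt : ∀ x, ‖w s x - FunctionSpaces.Torus.fourierTruncate N (w s) x‖ ^ 2 ≤
        2 * ‖w s x‖ ^ 2 + 2 * ‖FunctionSpaces.Torus.fourierTruncate N (w s) x‖ ^ 2 := fun x => by
      have h1 : ‖w s x - FunctionSpaces.Torus.fourierTruncate N (w s) x‖ ^ 2 ≤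
          (‖w s x‖ + ‖FunctionSpaces.Torus.fourierTruncate N (w s) x‖) ^ 2 :=
        pow_le_pow_left₀ (norm_nonneg _) (norm_sub_le _ _) 2
      nlinarith [h1, sq_nonneg (‖w s x‖ - ‖FunctionSpaces.Torus.fourierTruncate N (w s) x‖)]
    have i1 := hs.integrable_norm_pow two_ne_zero
    have i2 := hP.integrable_norm_pow two_ne_zero
    calc ∫ x, ‖w s x - FunctionSpaces.Torus.fourierTruncate N (w s) x‖ ^ 2
        ≤ ∫ x, (2 * ‖w s x‖ ^ 2 + 2 * ‖FunctionSpaces.Torus.fourierTruncate N (w s) x‖ ^ 2) :=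
          integral_mono_of_nonneg (ae_of_all _ fun x => sq_nonneg _) ((i1.const_mul 2).add (i2.const_mul 2))
            (ae_of_all _ hpt)
      _ = 2 * (∫ x, ‖w s x‖ ^ 2) + 2 * (∫ x, ‖FunctionSpaces.Torus.fourierTruncate N (w s) x‖ ^ 2) := by
          rw [integral_add (i1.const_mul 2) (i2.const_mul 2), integral_const_mul, integral_const_mul]
      _ ≤ 2 * (∫ x, ‖w s x‖ ^ 2) + 2 * (∫ x, ‖w s x‖ ^ 2) :=
          add_le_add le_rfl (mul_le_mul_of_nonneg_left
            (FunctionSpaces.Torus.integral_norm_sq_fourierTruncate_le hs N) (by norm_num))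
      _ = 4 * ∫ x, ‖w s x‖ ^ 2 := by ring
  refine ⟨fun N => ?_, hbound, ?_⟩
  · have hm : AEStronglyMeasurable (fun s => ∫ x, ‖w s x - FunctionSpaces.Torus.fourierTruncate N (w s) x‖ ^ 2)
        (volume.restrict (Ioo 0 T)) :=
      ((h.aestronglyMeasurable_uncurry.sub
        (Torus.aestronglyMeasurable_uncurry_fourierTruncate h.aestronglyMeasurable_uncurry N)).norm.pow 2).integral_prod_right'
    exact Integrable.mono' (h.integrableOn_integral_norm_sq.const_mul 4) hm (hbound N)
  · filter_upwards [hgood] with s hs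
    have ht := FunctionSpaces.Torus.tendsto_lintegral_enorm_sq_fourierTruncate_sub hs
    have hfinN : ∀ N, ∫⁻ x, ‖FunctionSpaces.Torus.fourierTruncate N (w s) x - w s x‖ₑ ^ 2 ≠ ⊤ := by
      intro N
      have hsub : MemLp (fun x => FunctionSpaces.Torus.fourierTruncate N (w s) x - w s x) 2 volume :=
        (FunctionSpaces.Torus.memLp_fourierTruncate N _ 2).sub hs
      have h2 := lintegral_rpow_enorm_lt_top_of_eLpNorm_lt_top two_ne_zero ENNReal.ofNat_ne_top hsub.eLpNorm_lt_top
      simp only [ENNReal.toReal_ofNat, ENNReal.rpow_two] at h2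
      exact h2.ne
    have hreal := (ENNReal.tendsto_toReal ENNReal.zero_ne_top).comp ht
    rw [ENNReal.toReal_zero] at hreal
    refine hreal.congr fun N => ?_
    rw [Function.comp_apply, ← integral_toReal]
    · refine integral_congr_ae (ae_of_all _ fun x => ?_)
      dsimp only
      rw [ENNReal.toReal_pow, toReal_enorm, norm_sub_rev]
    · exact (((FunctionSpaces.Torus.continuous_fourierTruncate N (w s)).aestronglyMeasurable.sub hs.1).enorm.pow_const 2)
    · exact ae_of_all _ fun x => ENNReal.pow_lt_top enorm_lt_top

/-- **The tails vanish in `L¹(0,T)`**: `∫₀ᵀ ∫‖w - P_N w‖² → 0` (dominated convergence).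
[cite: RobinsonRodrigoSadowski2016, §4.1 (Lemma 4.1)] -/
theorem tendsto_integral_galerkin_tail (h : IsWeakPassiveVectorOn A T ν b w₀ w) :
    Tendsto (fun N => ∫ s in Ioo 0 T, ∫ x, ‖w s x - FunctionSpaces.Torus.fourierTruncate N (w s) x‖ ^ 2) atTop (𝓝 0) := by
  obtain ⟨hint, hbound, hlim⟩ := h.galerkin_tail
  have := tendsto_integral_of_dominated_convergence (fun s => 4 * ∫ x, ‖w s x‖ ^ 2)
    (fun N => (hint N).aestronglyMeasurable) (h.integrableOn_integral_norm_sq.const_mul 4) hbound hlim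
  simpa using this

/-! ## The flux against the own truncation, rewritten and bounded -/

/-- **The flux of the truncated identity, for `A = 0`, is remainder minus dissipation**, and the
remainder is controlled by the tail and the truncated dissipation: for a carrier bounded by `M` a.e.,
for a.e. `s ∈ (0,T)`,
`Φ[w; P_N w(s)](s) = R_N(s) - ν‖∇P_N w(s)‖₂²`, `R_N(s) = ∫⟪w(s) - P_N w(s), (b(s)·∇)P_N w(s)⟫`,
`|R_N(s)| ≤ d M (∫‖w(s) - P_N w(s)‖²)^{1/2} (‖∇P_N w(s)‖₂²)^{1/2}`.
[cite: RobinsonRodrigoSadowski2016, §4.2 (4.20)] -/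
theorem ae_galerkinFlux_eq_remainder (h : IsWeakPassiveVectorOn 0 T ν b w₀ w) {M : ℝ} (hM : 0 ≤ M)
    (hbM : ∀ᵐ s ∂(volume.restrict (Ioo 0 T)), ∀ᵐ x ∂volume, ‖b s x‖ ≤ M) (N : ℕ) :
    ∀ᵐ s ∂(volume.restrict (Ioo 0 T)),
      ((∫ x, ⟪w s x, FunctionSpaces.Torus.convect (b s) (FunctionSpaces.Torus.fourierTruncate N (w s)) x +
            ν • FunctionSpaces.Torus.laplacian (FunctionSpaces.Torus.fourierTruncate N (w s)) x⟫_ℝ) +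
          (0 : ℝ) * ∫ x, ⟪b s x, FunctionSpaces.Torus.convect (w s) (FunctionSpaces.Torus.fourierTruncate N (w s)) x⟫_ℝ =
        (∫ x, ⟪w s x - FunctionSpaces.Torus.fourierTruncate N (w s) x,
            FunctionSpaces.Torus.convect (b s) (FunctionSpaces.Torus.fourierTruncate N (w s)) x⟫_ℝ) -
          ν * (FunctionSpaces.Torus.eGradNormSq (FunctionSpaces.Torus.fourierTruncate N (w s))).toReal) ∧
      |∫ x, ⟪w s x - FunctionSpaces.Torus.fourierTruncate N (w s) x,
          FunctionSpaces.Torus.convect (b s) (FunctionSpaces.Torus.fourierTruncate N (w s)) x⟫_ℝ| ≤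
        Fintype.card d * M * Real.sqrt (∫ x, ‖w s x - FunctionSpaces.Torus.fourierTruncate N (w s) x‖ ^ 2) *
          Real.sqrt ((FunctionSpaces.Torus.eGradNormSq (FunctionSpaces.Torus.fourierTruncate N (w s))).toReal) := by
  filter_upwards [h.ae_integrable_slice, h.ae_memLp_two, h.ae_isWeaklyDivFree_carrier, h.ae_aestronglyMeasurable_slice, hbM]
    with s hs hs2 hbdiv hsm hbs
  have hbint : Integrable (b s) volume := Integrable.of_bound hsm.2 M hbs
  refine ⟨?_, ?_⟩
  · rw [zero_mul, add_zero, integral_inner_convect_add_smul_laplacian_fourierTruncate hs.1 hs.2.1 ν N,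
      integral_inner_convect_fourierTruncate_eq_remainder hbint hbdiv hs.2.1 N]
  · have hv : MemLp (fun x => w s x - FunctionSpaces.Torus.fourierTruncate N (w s) x) 2 volume :=
      hs2.sub (FunctionSpaces.Torus.memLp_fourierTruncate N _ 2)
    have hb := abs_integral_inner_convect_le_of_norm_le (u := b s) hv hM hbs
      (FunctionSpaces.Torus.isSmooth_fourierTruncate N (w s))
    rwa [gradNormSq_fourierTruncate] at hb

end IsWeakPassiveVectorOn

end Torus

end Literature.Analysis.FluidPDE

end
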